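import Summits.ValiantsHypothesis.ValiantsHypothesis.Theorems.KPlusLogSqLawTropicalBSingleGaugeUniversal

/-!
# Route «KPlusLogSqLaw», crux `TropicalB` (stmt-ValiantsHypothesis-19771) — the universal bound with `G` GAUGE PIECES: `n + 1 ≤ G·((K−2)m² + m + 1)`

HONEST FRAMING.  Helper `--supports` the crux `…Theses.KPlusLogSqLaw.TropicalB` (item stmt-ValiantsHypothesis-19771, route KPlusLogSqLaw, DRAFT;
cell `pub-symmetroid`, seat val-sym-trop-p5 g11, 2026-08-27).  The piecewise form of THE UNIVERSAL SINGLE-GAUGE BOUND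
(`chain_le_of_universalGauge`, p577381): a dominant chain certified column-wise by affine row gauges that are constant on `G` consecutive index
pieces (`g : Fin (n+1) → Fin G` monotone, exactly the format of the tree's `chain_le_of_gaugePieces`), each gauge with pairwise distinct gauged
slopes, has **`n + 1 ≤ G · (m·(#middle types + 1) + 1) = G·((K−2)m² + m + 1)`** — versus the tree's `Σ_j (G·#types_j − 1)` (`= G·K·m² − m` for
full supports).  Proof: restrict the chain to a constant-gauge index interval and apply `chain_le_of_universalGauge`; then count fibres of `g`
(`piece_count`).  Nothing here bears on `TropicalB` in its window, `WeakLifting`, the doors, `MatrixDescartes` (stmt-ValiantsHypothesis-18050)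
or VP ≠ VNP.  [this seat]
-/


set_option linter.dupNamespace false
set_option autoImplicit false

namespace Summit.ValiantsHypothesis.ValiantsHypothesis.Theorems.KPlusLogSqLaw

open Summit.ValiantsHypothesis.ValiantsHypothesis.Theorems.MatrixDescartes.Negative
open scoped BigOperators
open Finset

namespace SingleGauge

variable {m K : ℕ}

/-- **Fibre counting for piecewise bounds.**  If `g : Fin (n+1) → Fin G` and any two indices `k ≤ k'` in the same fibre of `g` are at distance
`≤ B`, then `n + 1 ≤ G·(B + 1)` (each fibre lies in an interval of length `B` starting at its minimum). [folklore] -/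
theorem piece_count {n G B : ℕ} (g : Fin (n + 1) → Fin G)
    (hB : ∀ k k' : Fin (n + 1), k ≤ k' → g k = g k' → (k' : ℕ) - k ≤ B) :
    n + 1 ≤ G * (B + 1) := by
  classical
  have hfib : ∀ r ∈ (univ : Finset (Fin G)), (univ.filter fun k : Fin (n + 1) => g k = r).card ≤ B + 1 := by
    intro r _
    set S := univ.filter fun k : Fin (n + 1) => g k = r with hS
    rcases S.eq_empty_or_nonempty with h | h
    · rw [h, card_empty]; exact Nat.zero_le _
    · obtain ⟨k₀, hk₀, hmin⟩ := S.exists_min_image (fun k => (k : ℕ)) h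
      have hg0 : g k₀ = r := (mem_filter.mp hk₀).2
      calc S.card ≤ (range (B + 1)).card := by
            refine card_le_card_of_injOn (fun k => (k : ℕ) - k₀) ?_ ?_
            · intro k hk
              have hk' : k ∈ S := hk
              have hgk : g k = r := (mem_filter.mp hk').2
              have hle : (k₀ : ℕ) ≤ k := hmin k hk'
              have hd := hB k₀ k (Fin.le_iff_val_le_val.mpr hle) (by rw [hg0, hgk])
              show (k : ℕ) - k₀ ∈ (↑(range (B + 1)) : Set ℕ)
              rw [mem_coe, mem_range]; omega
            · intro a ha b hb hab
              have ha' : (k₀ : ℕ) ≤ a := hmin a ha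
              have hb' : (k₀ : ℕ) ≤ b := hmin b hb
              have hab' : (a : ℕ) - k₀ = (b : ℕ) - k₀ := hab
              exact Fin.ext (by omega)
        _ = B + 1 := card_range _
  have h := card_le_mul_card_image_of_maps_to (s := (univ : Finset (Fin (n + 1)))) (t := (univ : Finset (Fin G))) (f := g)
    (fun _ _ => mem_univ _) (B + 1) hfib
  rw [card_univ, Fintype.card_fin, card_univ, Fintype.card_fin] at h
  calc n + 1 ≤ (B + 1) * G := h
    _ = G * (B + 1) := Nat.mul_comm _ _

/-- **THE UNIVERSAL BOUND WITH GAUGE PIECES.**  A dominant chain with distinct consecutive terms, certified column-wise at time `k` by the affine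
row gauge number `g k` (`g` monotone into `Fin G`, `hcert` verbatim as in the tree's `chain_le_of_gaugePieces`), every gauge having pairwise distinct
gauged slopes (`hgen`), with a least exponent class `l₀` and a greatest one `l₁` (`d l₀ < d l₁`), has
`n + 1 ≤ G · (m·(#{(i,l) : l ≠ l₀, l ≠ l₁} + 1) + 1)`.  [this seat; from `chain_le_of_universalGauge` by restriction + `piece_count`] -/
theorem chain_le_of_universalGaugePieces (d : Fin K → ℕ) (v ε : Fin m → Fin m → Fin K → ℤ) {G : ℕ} (α β : Fin G → Fin m → ℚ)
    (hgen : ∀ (r : Fin G) (i i' : Fin m) (l l' : Fin K), (d l : ℚ) - α r i = (d l' : ℚ) - α r i' → i = i' ∧ l = l')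
    (l₀ l₁ : Fin K) (hd0 : ∀ l, d l₀ ≤ d l) (hd1 : ∀ l, d l ≤ d l₁) (h01 : d l₀ < d l₁)
    {n : ℕ} (θ : Fin (n + 1) → ℤ) (hθ : StrictMono θ) (p : Fin (n + 1) → Equiv.Perm (Fin m) × (Fin m → Fin K))
    (hdom : ∀ k, IsDominant d v ε (θ k) (p k)) (hne : ∀ k : Fin n, p k.castSucc ≠ p k.succ)
    (g : Fin (n + 1) → Fin G) (hg : Monotone g)
    (hcert : ∀ (k : Fin (n + 1)) (j i : Fin m) (l : Fin K), ε i j l ≠ 0 →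
      ((θ k : ℚ) * (d l : ℚ) - (v i j l : ℚ)) - (α (g k) i * (θ k : ℚ) + β (g k) i) ≤
        ((θ k : ℚ) * (d ((p k).2 j) : ℚ) - (v ((p k).1 j) j ((p k).2 j) : ℚ)) - (α (g k) ((p k).1 j) * (θ k : ℚ) + β (g k) ((p k).1 j))) :
    n + 1 ≤ G * (m * ((univ.filter fun il : Fin m × Fin K => il.2 ≠ l₀ ∧ il.2 ≠ l₁).card + 1) + 1) := by
  classical
  refine piece_count g ?_
  intro k k' hkk' hgk
  have hkk : (k : ℕ) ≤ k' := Fin.le_iff_val_le_val.mp hkk'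
  set L : ℕ := (k' : ℕ) - k with hL
  have hidx : ∀ t : Fin (L + 1), (k : ℕ) + t < n + 1 := fun t => by have := t.isLt; have := k'.isLt; omega
  let ι : Fin (L + 1) → Fin (n + 1) := fun t => ⟨(k : ℕ) + t, hidx t⟩
  have hι : StrictMono ι := by
    intro a b hab
    show (⟨(k : ℕ) + a, hidx a⟩ : Fin (n + 1)) < ⟨(k : ℕ) + b, hidx b⟩
    rw [Fin.mk_lt_mk]
    exact Nat.add_lt_add_left (Fin.lt_def.mp hab) _
  -- the gauge is constant on the interval
  have hgι : ∀ t, g (ι t) = g k := by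
    intro t
    have h1 : g k ≤ g (ι t) := hg (Fin.le_iff_val_le_val.mpr (Nat.le_add_right _ _))
    have h2 : g (ι t) ≤ g k' := hg (Fin.le_iff_val_le_val.mpr (by show (k : ℕ) + t ≤ k'; have := t.isLt; omega))
    rw [← hgk] at h2
    exact le_antisymm h2 h1
  -- the restricted chain
  have hne' : ∀ t : Fin L, (p ∘ ι) t.castSucc ≠ (p ∘ ι) t.succ := by
    intro t
    have ht : (k : ℕ) + t < n := by have := t.isLt; have := k'.isLt; omega
    have e1 : ι t.castSucc = (⟨(k : ℕ) + t, ht⟩ : Fin n).castSucc :=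
      Fin.ext (by simp only [ι, Fin.val_castSucc])
    have e2 : ι t.succ = (⟨(k : ℕ) + t, ht⟩ : Fin n).succ :=
      Fin.ext (by simp only [ι, Fin.val_succ]; omega)
    show p (ι t.castSucc) ≠ p (ι t.succ)
    rw [e1, e2]
    exact hne _
  have hcert' : ∀ (t : Fin (L + 1)) (j i : Fin m) (l : Fin K), ε i j l ≠ 0 →
      (((θ ∘ ι) t : ℚ) * (d l : ℚ) - (v i j l : ℚ)) - (α (g k) i * ((θ ∘ ι) t : ℚ) + β (g k) i) ≤
        (((θ ∘ ι) t : ℚ) * (d (((p ∘ ι) t).2 j) : ℚ) - (v (((p ∘ ι) t).1 j) j (((p ∘ ι) t).2 j) : ℚ)) -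
          (α (g k) (((p ∘ ι) t).1 j) * ((θ ∘ ι) t : ℚ) + β (g k) (((p ∘ ι) t).1 j)) := by
    intro t j i l hεl
    have h := hcert (ι t) j i l hεl
    rw [hgι t] at h
    exact h
  have h := chain_le_of_universalGauge d v ε (α (g k)) (β (g k)) (hgen (g k)) l₀ l₁ hd0 hd1 h01 (θ ∘ ι) (hθ.comp hι) (p ∘ ι)
    (fun t => hdom (ι t)) hne' hcert'
  exact h

/-- **Corollary (format form).**  Under the hypotheses of `chain_le_of_universalGaugePieces`: `n + 1 ≤ G·((K−2)·m² + m + 1)`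
(tree, `chain_le_of_gaugePieces`: `n ≤ Σ_j (G·#types_j − 1)`). [this seat] -/
theorem chain_le_of_universalGaugePieces' (d : Fin K → ℕ) (v ε : Fin m → Fin m → Fin K → ℤ) {G : ℕ} (α β : Fin G → Fin m → ℚ)
    (hgen : ∀ (r : Fin G) (i i' : Fin m) (l l' : Fin K), (d l : ℚ) - α r i = (d l' : ℚ) - α r i' → i = i' ∧ l = l')
    (l₀ l₁ : Fin K) (hd0 : ∀ l, d l₀ ≤ d l) (hd1 : ∀ l, d l ≤ d l₁) (h01 : d l₀ < d l₁)
    {n : ℕ} (θ : Fin (n + 1) → ℤ) (hθ : StrictMono θ) (p : Fin (n + 1) → Equiv.Perm (Fin m) × (Fin m → Fin K))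
    (hdom : ∀ k, IsDominant d v ε (θ k) (p k)) (hne : ∀ k : Fin n, p k.castSucc ≠ p k.succ)
    (g : Fin (n + 1) → Fin G) (hg : Monotone g)
    (hcert : ∀ (k : Fin (n + 1)) (j i : Fin m) (l : Fin K), ε i j l ≠ 0 →
      ((θ k : ℚ) * (d l : ℚ) - (v i j l : ℚ)) - (α (g k) i * (θ k : ℚ) + β (g k) i) ≤
        ((θ k : ℚ) * (d ((p k).2 j) : ℚ) - (v ((p k).1 j) j ((p k).2 j) : ℚ)) - (α (g k) ((p k).1 j) * (θ k : ℚ) + β (g k) ((p k).1 j))) :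
    n + 1 ≤ G * ((K - 2) * m ^ 2 + m + 1) := by
  have h := chain_le_of_universalGaugePieces d v ε α β hgen l₀ l₁ hd0 hd1 h01 θ hθ p hdom hne g hg hcert
  have hl : l₀ ≠ l₁ := fun e => by rw [e] at h01; exact lt_irrefl _ h01
  rw [card_types_mid l₀ l₁ hl] at h
  calc n + 1 ≤ G * (m * (m * (K - 2) + 1) + 1) := h
    _ = G * ((K - 2) * m ^ 2 + m + 1) := by ring

end SingleGauge

end Summit.ValiantsHypothesis.ValiantsHypothesis.Theorems.KPlusLogSqLaw
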